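/-
Copyright (c) 2026. All rights reserved.
Released under Apache 2.0 license as described in the file LICENSE.
-/
import Summits.Langlands.Langlands.Theorems.SoloInformedBmaxInvariantsWeakTCriterion
import Literature.NumberTheory.Automorphic.GLOneOfHeckeCharacterBJ
import Literature.NumberTheory.GaloisRepresentations.HeckeCharacterNormCharacter
import Literature.NumberTheory.GaloisRepresentations.CyclotomicCharacterFrobeniusProofs
import Literature.NumberTheory.GaloisRepresentations.ArtinCharacterReciprocity
import HarnessLib

/-!
# The summit's unramified clause and the crystalline clause D2-cris on genuine terms: `GL_1`, the pairs
# `(‖·‖^k ∘ det, χ_ℓ^k)` (rung Λ15)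

Programme `solo-Langlands-informed` (repair D2-cris of `Summit.Langlands`).  Every earlier certificate of the
programme quantified over an ABSTRACT automorphic datum ("for every `π` whose Satake parameter at `v` is …").  The
tree contains the automorphic side of `GL_1` in the Borel–Jacquet model (`Literature/…/GLOneOfHeckeCharacterBJ`:
`exists_automorphicRepData_detTwist_glOne`, the automorphic representation `π_θ = ℂ·(θ∘det)/⊥` of `GL_1(𝔸_K)`
attached to a Hecke character `θ`, and `AutomorphicRepData.hasSatakeParamAt_detTwist_glOne`, its Satake parameters
away from a level of `θ`).  This file evaluates the two `𝓡`-free clauses of the reciprocity statement — the summit's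
unramified clause `SatakeFrobCompatibleAt` (Statement, clause (C): the ARITHMETIC Frobenius has characteristic
polynomial `∏ (X - ι⁻¹(α_j⁻¹))`, `arithFrobPolyOfSatake ι q_v 1 α`) and the repair's crystalline clause
`D2Cris.CrystallineCompatibleAt` (`charpoly (φ^{f(v|ℓ)} | D_cris(ρ|Γ_{K_v})) = (∏ (X - ι⁻¹ α_j))^{f(v|ℓ)}`) — on
GENUINE terms on both sides, for every number field `K`, every prime `ℓ` and every `ι : ℚ̄_ℓ ≃ ℂ`:

* §1 `π_θ` for `θ` of level one (`θ∘det` trivial on `K(⊤)`) has the Satake parameter `{θ(⟨ϖ_w⟩_w)}` at EVERY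
  finite place `w` (`hasSatakeParamAt_detTwist_glOne_of_level_top`) and no other (Flath uniqueness,
  `AutomorphicRepData.hasSatakeParamAt_unique_holds`): `{1}` for `θ = 𝟙` and `{q_w^{-k}}` for `θ = ‖·‖^k`
  (`hasSatakeParamAt_trivial_glOne`, `hasSatakeParamAt_normPow_glOne`; Tate's unramified quasi-characters).
* §2 the trivial pair `(π_𝟙, 𝟙)`: ★ `SatakeFrobCompatibleAt ι π_𝟙 𝟙 v` at EVERY finite `v` and
  ★★ `CrystallineCompatibleAt ι π_𝟙 𝟙 v hv` at EVERY `v ∣ ℓ` (rung Λ14 `crystallineCompatibleAt_one`), NO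
  hypothesis (`exists_glOne_trivial_pair`) — the first pair of genuine terms of the tree on which both the summit's
  clause (C) and the repaired `v ∣ ℓ` clause are theorems.
* §3 the Tate pairs `(π_{‖·‖^k}, χ_ℓ^k)`, `k : ℕ`, `χ_ℓ^k := 𝟙 ⊗ tateChar K ℓ k` (Λ13): ★★ the summit's clause at
  every `v ∤ ℓ` — `χ_ℓ(Frob_v) = q_v` (tree `GaloisRep.cyclotomicCharacter_apply_of_isArithFrobAt`) against the
  predicted `X - ι⁻¹((q_v^{-k})⁻¹) = X - q_v^k` — hence the `𝓡`-free conjunct `∀ᶠ v, SatakeFrobCompatibleAt ι π ρ v`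
  of the summit's `Corresponds 𝓡 ι π ρ`; ★★★ the repair's clause at every `v ∣ ℓ` (Λ14
  `crystallineCompatibleAt_twist_one_tateChar_all`, fed by `q_v = ℓ^{f(v|ℓ)}`): `exists_glOne_tate_pair`.
  The two clauses use opposite Frobenii (arithmetic in (C); `φ^{f}` = geometric in D2-cris, Fontaine) and mutually
  inverse parameters (`α⁻¹` vs `α`); §3 is the check, on the one family where both sides are computable in the tree,
  that the two conventions are consistent with each other: with either inversion dropped, one of
  `satakeFrobCompatibleAt_normPow_tateChar`, `crystallineCompatibleAt_normPow_tateChar` would fail for `k ≥ 1`.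

No new definitions and no period-ring mathematics (the `v ∣ ℓ` content is Λ9–Λ14); the file is the evaluation of
the clauses on the terms the tree provides.

References: Tate, *Fourier analysis in number fields and Hecke's zeta-functions* (1950), §2.3, in Cassels–Fröhlich
(1967), Ch. XV; Borel–Jacquet, Proc. Sympos. Pure Math. 33 (1979), part 1, 4.6; Serre, *Abelian ℓ-adic
representations and elliptic curves* (1968), Ch. I §1.2 (`χ_ℓ(F_v) = Nv`); Buzzard–Gee, LMS LNS 414 (2014),
Conj. 3.2.1, Conj. 3.2.2, Rem. 3.2.5; Fontaine, Astérisque 223 (1994), Exp. VIII §2.3.7.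
-/

noncomputable section

open scoped MatrixGroups Matrix Classical Polynomial NumberField
open NumberField IsDedekindDomain Field Polynomial Filter
open Literature.NumberTheory.Automorphic Literature.NumberTheory.GaloisRepresentations

namespace Summit.Langlands.Langlands.Theorems

namespace D2Cris

/-! ### §1 `GL_1`: the Satake parameters of `π_θ` at every finite place, for `θ` of level one -/

section GLOne

variable {K : Type} [Field K] [NumberField K] (hcpt : isCompact_glFiniteIntegralLevel 1 K)

/-- Every finite place `w` of `K` has a uniformiser, as a unit of `K_w` (Mathlib `valuation_exists_uniformizer`,
transported to the completion by `valuedAdicCompletion_eq_valuation'`). [folklore] -/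
theorem exists_units_valued_eq_exp_neg_one (w : HeightOneSpectrum (𝓞 K)) :
    ∃ ϖ : (w.adicCompletion K)ˣ, Valued.v (ϖ : w.adicCompletion K) = WithZero.exp (-1 : ℤ) := by
  obtain ⟨π, hπ⟩ := w.valuation_exists_uniformizer K
  have hπv : Valued.v (π : w.adicCompletion K) = WithZero.exp (-1 : ℤ) := by
    rw [HeightOneSpectrum.valuedAdicCompletion_eq_valuation', hπ]
  have hπ0 : (π : w.adicCompletion K) ≠ 0 := fun h => by
    rw [h, map_zero] at hπv
    exact WithZero.exp_ne_zero hπv.symm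
  exact ⟨Units.mk0 _ hπ0, hπv⟩

/-- The unit ideal is a non-zero ideal divisible by no finite prime. [folklore] -/
private theorem top_ne_zero_and_not_dvd (w : HeightOneSpectrum (𝓞 K)) :
    (⊤ : Ideal (𝓞 K)) ≠ 0 ∧ ¬ w.asIdeal ∣ (⊤ : Ideal (𝓞 K)) := by
  refine ⟨fun h => ?_, fun h => w.isPrime.ne_top (top_le_iff.mp (Ideal.dvd_iff_le.mp h))⟩
  have h1 : (1 : 𝓞 K) ∈ (⊤ : Ideal (𝓞 K)) := Submodule.mem_top
  rw [h, Ideal.zero_eq_bot, Ideal.mem_bot] at h1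
  exact one_ne_zero h1

/-- **The Satake parameter of `π_θ` at EVERY finite place, for `θ` of level one.**  If `θ ∘ det` is trivial on
the full principal congruence subgroup `K(⊤)` of `GL_1(𝔸_K)`, then for every finite place `w` and every
uniformiser `ϖ` of `K_w` the Borel–Jacquet datum `π_θ = ℂ·(θ∘det)/⊥` has Satake parameter `{θ(⟨ϖ⟩_w)}` at `w`
(`AutomorphicRepData.hasSatakeParamAt_detTwist_glOne` at the level `𝔪 = ⊤`, which no `w` divides).
[cite: BorelJacquet1979, 4.6] [cite: TateThesis1967, Ch. XV, §2.3] -/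
theorem hasSatakeParamAt_detTwist_glOne_of_level_top {θ : HeckeCharacter K}
    {π : AutomorphicRepData (AutomorphyDatum.gl 1 K hcpt)}
    (hW : π.W = Submodule.span ℂ {fun g : (AdelicGroupData.gl 1 K).Adelic => (detTwist 1 θ g : ℂ)})
    (hW' : π.W' = ⊥) (hθ : ∀ k ∈ principalCongruenceLevel 1 K ⊤, detTwist 1 θ k = 1)
    (w : HeightOneSpectrum (𝓞 K)) {ϖ : (w.adicCompletion K)ˣ}
    (hϖ : Valued.v (ϖ : w.adicCompletion K) = WithZero.exp (-1 : ℤ)) :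
    π.HasSatakeParamAt w {((θ (localUnits w ϖ) : ℂˣ) : ℂ)} :=
  AutomorphicRepData.hasSatakeParamAt_detTwist_glOne hcpt hW hW' (top_ne_zero_and_not_dvd w).1 hθ w
    (top_ne_zero_and_not_dvd w).2 hϖ

/-- … and `π_θ` has no other Satake parameter at `w` (Flath's uniqueness of Satake parameters, tree
`AutomorphicRepData.hasSatakeParamAt_unique_holds`). [cite: BorelJacquet1979, 4.6] -/
theorem eq_of_hasSatakeParamAt_detTwist_glOne_of_level_top {θ : HeckeCharacter K}
    {π : AutomorphicRepData (AutomorphyDatum.gl 1 K hcpt)}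
    (hW : π.W = Submodule.span ℂ {fun g : (AdelicGroupData.gl 1 K).Adelic => (detTwist 1 θ g : ℂ)})
    (hW' : π.W' = ⊥) (hθ : ∀ k ∈ principalCongruenceLevel 1 K ⊤, detTwist 1 θ k = 1)
    (w : HeightOneSpectrum (𝓞 K)) {ϖ : (w.adicCompletion K)ˣ}
    (hϖ : Valued.v (ϖ : w.adicCompletion K) = WithZero.exp (-1 : ℤ)) {α : Multiset ℂ}
    (hα : π.HasSatakeParamAt w α) : α = {((θ (localUnits w ϖ) : ℂˣ) : ℂ)} :=
  AutomorphicRepData.hasSatakeParamAt_unique_holds π hα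
    (hasSatakeParamAt_detTwist_glOne_of_level_top hcpt hW hW' hθ w hϖ)

/-- `𝟙 ∘ det = 1` on `GL_1(𝔸_K)`: the trivial Hecke character has level one. [folklore] -/
theorem detTwist_one_apply (g : GL (Fin 1) (AdeleRing (𝓞 K) K)) : detTwist 1 (1 : HeckeCharacter K) g = 1 := by
  rw [detTwist_apply, HeckeCharacter.one_apply]

/-- ★ **The trivial automorphic representation `π_𝟙 = ℂ·1/⊥` of `GL_1(𝔸_K)` has Satake parameter `{1}` at every
finite place.** [cite: BorelJacquet1979, 4.6] -/
theorem hasSatakeParamAt_trivial_glOne {π : AutomorphicRepData (AutomorphyDatum.gl 1 K hcpt)}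
    (hW : π.W = Submodule.span ℂ
      {fun g : (AdelicGroupData.gl 1 K).Adelic => (detTwist 1 (1 : HeckeCharacter K) g : ℂ)})
    (hW' : π.W' = ⊥) (w : HeightOneSpectrum (𝓞 K)) : π.HasSatakeParamAt w {1} := by
  obtain ⟨ϖ, hϖ⟩ := exists_units_valued_eq_exp_neg_one w
  have h := hasSatakeParamAt_detTwist_glOne_of_level_top hcpt hW hW' (fun k _ => detTwist_one_apply k) w hϖ
  rwa [HeckeCharacter.one_apply, Units.val_one] at h

/-- … and no other. [cite: BorelJacquet1979, 4.6] -/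
theorem eq_singleton_one_of_hasSatakeParamAt_trivial_glOne {π : AutomorphicRepData (AutomorphyDatum.gl 1 K hcpt)}
    (hW : π.W = Submodule.span ℂ
      {fun g : (AdelicGroupData.gl 1 K).Adelic => (detTwist 1 (1 : HeckeCharacter K) g : ℂ)})
    (hW' : π.W' = ⊥) {w : HeightOneSpectrum (𝓞 K)} {α : Multiset ℂ} (hα : π.HasSatakeParamAt w α) :
    α = {1} :=
  AutomorphicRepData.hasSatakeParamAt_unique_holds π hα (hasSatakeParamAt_trivial_glOne hcpt hW hW' w)

/-- `‖x‖^k = ‖x‖^{(k : ℂ)}`: the Hecke character `‖·‖^k` in the `cpow` currency of `AutomorphicTwistNorm`.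
[cite: TateThesis1967, Ch. XV, §2.3] -/
theorem normCharacter_pow_apply_eq_cpow (k : ℕ) (x : ideleGroup K) :
    (((HeckeCharacter.normCharacter K ^ k) x : ℂˣ) : ℂ) =
      (Literature.NumberTheory.GaloisRepresentations.ideleNorm x : ℂ) ^ ((k : ℕ) : ℂ) := by
  rw [HeckeCharacter.pow_apply, Units.val_pow_eq_pow_val, HeckeCharacter.normCharacter_apply, Complex.cpow_natCast]

include hcpt in
/-- `‖det‖^k` has level one (it is trivial on every `K(𝔫)`, `detTwist_eq_one_of_mem_principalCongruenceLevel`).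
[folklore] -/
theorem detTwist_normCharacter_pow_eq_one (k : ℕ) {g : GL (Fin 1) (AdeleRing (𝓞 K) K)}
    (hg : g ∈ principalCongruenceLevel 1 K ⊤) : detTwist 1 (HeckeCharacter.normCharacter K ^ k) g = 1 :=
  detTwist_eq_one_of_mem_principalCongruenceLevel hcpt (normCharacter_pow_apply_eq_cpow k) ⊤ hg

/-- **`‖⟨ϖ_w⟩_w‖^k = q_w^{-k}`** for a uniformiser `ϖ_w` of `K_w` (`det t_{w,1} = ⟨ϖ_w⟩_w`,
`detTwist_heckeDiagAt_one_glOne`, and `|det t_{w,1}|^s = q_w^{-s}`, `detTwist_heckeDiagAt_of_cpow`).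
[cite: TateThesis1967, Ch. XV, §2.3] -/
theorem normCharacter_pow_localUnits (k : ℕ) (w : HeightOneSpectrum (𝓞 K)) {ϖ : (w.adicCompletion K)ˣ}
    (hϖ : Valued.v (ϖ : w.adicCompletion K) = WithZero.exp (-1 : ℤ)) :
    (((HeckeCharacter.normCharacter K ^ k) (localUnits w ϖ) : ℂˣ) : ℂ) = ((w.residueCard : ℂ) ^ k)⁻¹ := by
  rw [← detTwist_heckeDiagAt_one_glOne (HeckeCharacter.normCharacter K ^ k) w ϖ,
    detTwist_heckeDiagAt_of_cpow (normCharacter_pow_apply_eq_cpow k) hϖ le_rfl, pow_one, Complex.cpow_neg,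
    Complex.cpow_natCast]

/-- ★ **The automorphic representation `π_{‖·‖^k} = ℂ·‖det‖^k/⊥` of `GL_1(𝔸_K)` has Satake parameter `{q_w^{-k}}` at
every finite place `w`.** [cite: BorelJacquet1979, 4.6] [cite: TateThesis1967, Ch. XV, §2.3] -/
theorem hasSatakeParamAt_normPow_glOne (k : ℕ) {π : AutomorphicRepData (AutomorphyDatum.gl 1 K hcpt)}
    (hW : π.W = Submodule.span ℂ
      {fun g : (AdelicGroupData.gl 1 K).Adelic => (detTwist 1 (HeckeCharacter.normCharacter K ^ k) g : ℂ)})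
    (hW' : π.W' = ⊥) (w : HeightOneSpectrum (𝓞 K)) :
    π.HasSatakeParamAt w {((w.residueCard : ℂ) ^ k)⁻¹} := by
  obtain ⟨ϖ, hϖ⟩ := exists_units_valued_eq_exp_neg_one w
  have h := hasSatakeParamAt_detTwist_glOne_of_level_top hcpt hW hW'
    (fun g hg => detTwist_normCharacter_pow_eq_one hcpt k hg) w hϖ
  rwa [normCharacter_pow_localUnits k w hϖ] at h

/-- … and no other. [cite: BorelJacquet1979, 4.6] -/
theorem eq_of_hasSatakeParamAt_normPow_glOne (k : ℕ) {π : AutomorphicRepData (AutomorphyDatum.gl 1 K hcpt)}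
    (hW : π.W = Submodule.span ℂ
      {fun g : (AdelicGroupData.gl 1 K).Adelic => (detTwist 1 (HeckeCharacter.normCharacter K ^ k) g : ℂ)})
    (hW' : π.W' = ⊥) {w : HeightOneSpectrum (𝓞 K)} {α : Multiset ℂ} (hα : π.HasSatakeParamAt w α) :
    α = {((w.residueCard : ℂ) ^ k)⁻¹} :=
  AutomorphicRepData.hasSatakeParamAt_unique_holds π hα (hasSatakeParamAt_normPow_glOne hcpt k hW hW' w)

end GLOne

/-! ### §2 The trivial pair `(π_𝟙, 𝟙)`: both clauses at every place -/

section Trivial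

variable {K : Type} [Field K] [NumberField K] (hcpt : isCompact_glFiniteIntegralLevel 1 K)
  {A : Type*} [CommRing A] [TopologicalSpace A] {n : ℕ} {ℓ : ℕ} [Fact ℓ.Prime]

omit [NumberField K] in
/-- The trivial framed Galois representation is unramified at every finite place. [folklore] -/
theorem isUnramifiedAt_one (v : HeightOneSpectrum (𝓞 K)) : (1 : FramedGaloisRep K A n).IsUnramifiedAt v :=
  fun _ _ _ _ => rfl

/-- In rank one the trivial representation has Frobenius characteristic polynomial `X - 1` at every finite place
(`charpoly` of the `1 × 1` identity matrix). [folklore] -/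
theorem hasFrobCharpolyAt_one (v : HeightOneSpectrum (𝓞 K)) :
    (1 : FramedGaloisRep K A 1).HasFrobCharpolyAt v (X - C 1) :=
  (FramedGaloisRep.hasFrobCharpolyAt_iff_of_rank_one _ v _).2 fun _ _ σ _ => by
    change ((1 : GL (Fin 1) A) : Matrix (Fin 1) (Fin 1) A) 0 0 = 1
    rw [Units.val_one, Matrix.one_apply_eq]

/-- `arithFrobPolyOfSatake ι q 1 {a} = X - ι⁻¹(a⁻¹)`: at shift `m = 1` the summit's predicted arithmetic-Frobenius
polynomial of a one-element parameter (no half-twist). [cite: BuzzardGeeLMS2014, Conj. 3.2.1 and Rem. 3.2.5] -/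
theorem arithFrobPolyOfSatake_one_singleton (ι : PadicAlgCl ℓ ≃+* ℂ) (q : ℕ) (a : ℂ) :
    arithFrobPolyOfSatake ι q 1 {a} = X - C (ι.symm a⁻¹) := by
  simp [arithFrobPolyOfSatake]

/-- ★ **The summit's unramified clause (C) for the trivial pair, at EVERY finite place**: `π_𝟙` has the Satake
parameter `{1}` at `v`, `𝟙` is unramified at `v`, and every arithmetic Frobenius has characteristic polynomial
`X - ι⁻¹(1⁻¹) = X - 1`. [cite: BuzzardGeeLMS2014, Conj. 3.2.1 and Rem. 3.2.5] -/
theorem satakeFrobCompatibleAt_trivial_glOne (ι : PadicAlgCl ℓ ≃+* ℂ)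
    {π : AutomorphicRepData (AutomorphyDatum.gl 1 K hcpt)}
    (hW : π.W = Submodule.span ℂ
      {fun g : (AdelicGroupData.gl 1 K).Adelic => (detTwist 1 (1 : HeckeCharacter K) g : ℂ)})
    (hW' : π.W' = ⊥) (v : HeightOneSpectrum (𝓞 K)) :
    SatakeFrobCompatibleAt ι π (1 : FramedGaloisRep K (PadicAlgCl ℓ) 1) v := by
  refine ⟨{1}, hasSatakeParamAt_trivial_glOne hcpt hW hW' v, isUnramifiedAt_one v, ?_⟩
  rw [arithFrobPolyOfSatake_one_singleton, inv_one, map_one]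
  exact hasFrobCharpolyAt_one v

/-- ★★ **The crystalline clause D2-cris for the trivial pair at EVERY place `v ∣ ℓ`, no hypothesis**: the only
Satake parameter of `π_𝟙` at `v` is `{1}` (§1), and `D_cris(𝟙|Γ_{K_v})` has a basis of size `f(v|ℓ)` with
`charpoly (φ^{f(v|ℓ)}) = (X - 1)^{f(v|ℓ)}` (rung Λ14 `crystallineCompatibleAt_one`).
[cite: BuzzardGeeLMS2014, Conj. 3.2.2] [cite: Colmez1998Annals, Lemme III.3.4] -/
theorem crystallineCompatibleAt_trivial_glOne (ι : PadicAlgCl ℓ ≃+* ℂ)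
    {π : AutomorphicRepData (AutomorphyDatum.gl 1 K hcpt)}
    (hW : π.W = Submodule.span ℂ
      {fun g : (AdelicGroupData.gl 1 K).Adelic => (detTwist 1 (1 : HeckeCharacter K) g : ℂ)})
    (hW' : π.W' = ⊥) (v : HeightOneSpectrum (𝓞 K)) (hv : ((ℓ : ℕ) : 𝓞 K) ∈ v.asIdeal) :
    CrystallineCompatibleAt ι π (1 : FramedGaloisRep K (PadicAlgCl ℓ) 1) v hv :=
  crystallineCompatibleAt_one ι π v hv fun α hα => by
    rw [eq_singleton_one_of_hasSatakeParamAt_trivial_glOne hcpt hW hW' hα, Multiset.replicate_one]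

/-- ★★ **The trivial pair of genuine terms.**  For every number field `K` (with the standing compactness witness
`hcpt` of the `GL_1` level structure), every prime `ℓ` and every `ι : ℚ̄_ℓ ≃ ℂ` there is an automorphic
representation `π` of `GL_1(𝔸_K)` in the Borel–Jacquet model — `π = ℂ·(𝟙∘det)/⊥`, the trivial representation —
such that, with `ρ = 𝟙 : Γ_K → GL_1(ℚ̄_ℓ)`: `π` has Satake parameter `{1}` at every finite place; the summit's
clause `SatakeFrobCompatibleAt ι π ρ v` holds at EVERY finite place (so the `𝓡`-free conjunct
`∀ᶠ v, SatakeFrobCompatibleAt ι π ρ v` of `Corresponds 𝓡 ι π ρ` holds for every `𝓡`); and the repaired `v ∣ ℓ`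
clause `CrystallineCompatibleAt ι π ρ v hv` holds at EVERY `v ∣ ℓ`.
[cite: BuzzardGeeLMS2014, Conj. 3.2.1 and Conj. 3.2.2] [cite: BorelJacquet1979, 4.6] -/
theorem exists_glOne_trivial_pair (ι : PadicAlgCl ℓ ≃+* ℂ) :
    ∃ π : AutomorphicRepData (AutomorphyDatum.gl 1 K hcpt),
      π.W = Submodule.span ℂ
          {fun g : (AdelicGroupData.gl 1 K).Adelic => (detTwist 1 (1 : HeckeCharacter K) g : ℂ)} ∧
        π.W' = ⊥ ∧
        (∀ v : HeightOneSpectrum (𝓞 K), π.HasSatakeParamAt v {1}) ∧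
        (∀ v : HeightOneSpectrum (𝓞 K), SatakeFrobCompatibleAt ι π (1 : FramedGaloisRep K (PadicAlgCl ℓ) 1) v) ∧
        (∀ᶠ v : HeightOneSpectrum (𝓞 K) in cofinite,
          SatakeFrobCompatibleAt ι π (1 : FramedGaloisRep K (PadicAlgCl ℓ) 1) v) ∧
        ∀ (v : HeightOneSpectrum (𝓞 K)) (hv : ((ℓ : ℕ) : 𝓞 K) ∈ v.asIdeal),
          CrystallineCompatibleAt ι π (1 : FramedGaloisRep K (PadicAlgCl ℓ) 1) v hv := by
  obtain ⟨π, hW, hW'⟩ := exists_automorphicRepData_detTwist_glOne hcpt (1 : HeckeCharacter K)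
  exact ⟨π, hW, hW', fun v => hasSatakeParamAt_trivial_glOne hcpt hW hW' v,
    fun v => satakeFrobCompatibleAt_trivial_glOne hcpt ι hW hW' v,
    Eventually.of_forall fun v => satakeFrobCompatibleAt_trivial_glOne hcpt ι hW hW' v,
    fun v hv => crystallineCompatibleAt_trivial_glOne hcpt ι hW hW' v hv⟩

end Trivial

/-! ### §3 The Tate pairs `(π_{‖·‖^k}, χ_ℓ^k)`: clause (C) away from `ℓ`, clause D2-cris above `ℓ` -/

section Tate

variable {K : Type} [Field K] [NumberField K] (hcpt : isCompact_glFiniteIntegralLevel 1 K)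
  {ℓ : ℕ} [Fact ℓ.Prime]

omit [NumberField K] in
/-- The entry of the `1 × 1` matrix `(𝟙 ⊗ χ_ℓ^k)(σ)` is `χ_ℓ(σ)^k` (from `ℚ_ℓ`). [folklore] -/
theorem twist_one_tateChar_apply_coe (k : ℕ) (σ : absoluteGaloisGroup K) :
    ((FramedRep.twist (1 : FramedGaloisRep K (PadicAlgCl ℓ) 1) (tateChar K ℓ k) σ : GL (Fin 1) (PadicAlgCl ℓ)) :
        Matrix (Fin 1) (Fin 1) (PadicAlgCl ℓ)) 0 0 = algebraMap ℚ_[ℓ] (PadicAlgCl ℓ) (cycQp σ ^ k) := by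
  rw [coe_twist_tateChar]
  change (algebraMap ℚ_[ℓ] (PadicAlgCl ℓ) (cycQp σ ^ k) •
    ((1 : GL (Fin 1) (PadicAlgCl ℓ)) : Matrix (Fin 1) (Fin 1) (PadicAlgCl ℓ))) 0 0 = _
  rw [Units.val_one, Matrix.smul_apply, Matrix.one_apply_eq, smul_eq_mul, mul_one]

/-- ★ **`χ_ℓ^k = 𝟙 ⊗ tateChar K ℓ k` is unramified at every `v ∤ ℓ`** (the cyclotomic character is,
`FramedGaloisRep.isUnramifiedAt_cyclotomic_holds`). [cite: SerreAbelianLadic1968, Ch. I §1.2 (Example: the cyclotomic character)] -/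
theorem isUnramifiedAt_twist_one_tateChar (k : ℕ) {v : HeightOneSpectrum (𝓞 K)}
    (hv : ((ℓ : ℕ) : 𝓞 K) ∉ v.asIdeal) :
    FramedGaloisRep.IsUnramifiedAt v (FramedRep.twist (1 : FramedGaloisRep K (PadicAlgCl ℓ) 1) (tateChar K ℓ k)) := by
  intro 𝔓 h𝔓 σ hσ
  have h1 : FramedGaloisRep.cyclotomic K ℓ σ = 1 :=
    FramedGaloisRep.isUnramifiedAt_cyclotomic_holds K ℓ hv 𝔓 h𝔓 σ hσ
  have h2 : GaloisRep.cyclotomicCharacter K ℓ σ = 1 := by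
    rw [← FramedGaloisRep.det_cyclotomic_apply, FramedRep.det_apply, h1, map_one]
  have h3 : tateChar K ℓ k σ = 1 := Units.ext (by
    rw [coe_tateChar, cycQp, h2, Units.val_one, PadicInt.coe_one, one_pow, map_one, Units.val_one])
  rw [FramedRep.twist_apply, h3, map_one, one_mul]
  rfl

/-- ★ **Every arithmetic Frobenius at `v ∤ ℓ` has characteristic polynomial `X - q_v^k` on `χ_ℓ^k`**
(`χ_ℓ(Frob_v) = q_v`, tree `GaloisRep.cyclotomicCharacter_apply_of_isArithFrobAt`).
[cite: SerreAbelianLadic1968, Ch. I §1.2 (Example: the cyclotomic character)] -/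
theorem hasFrobCharpolyAt_twist_one_tateChar (k : ℕ) {v : HeightOneSpectrum (𝓞 K)}
    (hv : ((ℓ : ℕ) : 𝓞 K) ∉ v.asIdeal) :
    FramedGaloisRep.HasFrobCharpolyAt v (X - C ((v.residueCard : PadicAlgCl ℓ) ^ k))
      (FramedRep.twist (1 : FramedGaloisRep K (PadicAlgCl ℓ) 1) (tateChar K ℓ k)) :=
  (FramedGaloisRep.hasFrobCharpolyAt_iff_of_rank_one _ v _).2 fun 𝔓 h𝔓 Φ hΦ => by
    rw [twist_one_tateChar_apply_coe, cycQp, GaloisRep.cyclotomicCharacter_apply_of_isArithFrobAt hv h𝔓 hΦ,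
      PadicInt.coe_natCast, map_pow, map_natCast]

/-- `arithFrobPolyOfSatake ι q 1 {q^{-k}} = X - q^k`: the polynomial the summit predicts from the Satake parameter
of `‖·‖^k` is the characteristic polynomial of `χ_ℓ^k(Frob_v)`. [cite: BuzzardGeeLMS2014, Conj. 3.2.1 and Rem. 3.2.5] -/
theorem arithFrobPolyOfSatake_one_singleton_inv_pow (ι : PadicAlgCl ℓ ≃+* ℂ) (q k : ℕ) :
    arithFrobPolyOfSatake ι q 1 {((q : ℂ) ^ k)⁻¹} = X - C ((q : PadicAlgCl ℓ) ^ k) := by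
  rw [arithFrobPolyOfSatake_one_singleton, inv_inv, map_pow, map_natCast]

/-- ★★ **The summit's unramified clause (C) for the Tate pair `(π_{‖·‖^k}, χ_ℓ^k)` at every `v ∤ ℓ`.**
[cite: BuzzardGeeLMS2014, Conj. 3.2.1 and Rem. 3.2.5] [cite: SerreAbelianLadic1968, Ch. I §1.2 (Example: the cyclotomic character)] -/
theorem satakeFrobCompatibleAt_normPow_tateChar (ι : PadicAlgCl ℓ ≃+* ℂ) (k : ℕ)
    {π : AutomorphicRepData (AutomorphyDatum.gl 1 K hcpt)}
    (hW : π.W = Submodule.span ℂ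
      {fun g : (AdelicGroupData.gl 1 K).Adelic => (detTwist 1 (HeckeCharacter.normCharacter K ^ k) g : ℂ)})
    (hW' : π.W' = ⊥) {v : HeightOneSpectrum (𝓞 K)} (hv : ((ℓ : ℕ) : 𝓞 K) ∉ v.asIdeal) :
    SatakeFrobCompatibleAt ι π (FramedRep.twist (1 : FramedGaloisRep K (PadicAlgCl ℓ) 1) (tateChar K ℓ k)) v := by
  refine ⟨{((v.residueCard : ℂ) ^ k)⁻¹}, hasSatakeParamAt_normPow_glOne hcpt k hW hW' v,
    isUnramifiedAt_twist_one_tateChar k hv, ?_⟩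
  rw [arithFrobPolyOfSatake_one_singleton_inv_pow]
  exact hasFrobCharpolyAt_twist_one_tateChar k hv

/-- ★★★ **The crystalline clause D2-cris for the Tate pair `(π_{‖·‖^k}, χ_ℓ^k)` at EVERY place `v ∣ ℓ`**: the
Satake parameter `{q_v^{-k}} = {ℓ^{-k f(v|ℓ)}}` (`q_v = ℓ^{f(v|ℓ)}`) is the one rung Λ14
`crystallineCompatibleAt_twist_one_tateChar_all` asks for. [cite: BuzzardGeeLMS2014, Conj. 3.2.2]
[cite: FontaineAsterisque223VIII, §2.3.7] -/
theorem crystallineCompatibleAt_normPow_tateChar (ι : PadicAlgCl ℓ ≃+* ℂ) (k : ℕ)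
    {π : AutomorphicRepData (AutomorphyDatum.gl 1 K hcpt)}
    (hW : π.W = Submodule.span ℂ
      {fun g : (AdelicGroupData.gl 1 K).Adelic => (detTwist 1 (HeckeCharacter.normCharacter K ^ k) g : ℂ)})
    (hW' : π.W' = ⊥) (v : HeightOneSpectrum (𝓞 K)) (hv : ((ℓ : ℕ) : 𝓞 K) ∈ v.asIdeal) :
    CrystallineCompatibleAt ι π (FramedRep.twist (1 : FramedGaloisRep K (PadicAlgCl ℓ) 1) (tateChar K ℓ k))
      v hv := by
  refine crystallineCompatibleAt_twist_one_tateChar_all ι π v hv k ?_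
  have hq : v.residueCard = ℓ ^ v.asIdeal.inertiaDeg ℤ := by
    rw [← residueFieldCard_adicCompletion_eq K v, residueFieldCard_adicCompletion_eq_pow_inertiaDeg v hv]
  have h := hasSatakeParamAt_normPow_glOne hcpt k hW hW' v
  rw [hq, Nat.cast_pow, ← pow_mul, mul_comm (v.asIdeal.inertiaDeg ℤ) k] at h
  simpa only [Multiset.replicate_one] using h

/-- ★★★ **The Tate pairs of genuine terms.**  For every number field `K`, prime `ℓ`, `ι : ℚ̄_ℓ ≃ ℂ` and `k : ℕ`
there is an automorphic representation `π` of `GL_1(𝔸_K)` in the Borel–Jacquet model — `π = ℂ·‖det‖^k/⊥` —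
such that, with `ρ = χ_ℓ^k = 𝟙 ⊗ tateChar K ℓ k : Γ_K → GL_1(ℚ̄_ℓ)`: `π` has Satake parameter `{q_v^{-k}}` at
every finite `v`; the summit's clause `SatakeFrobCompatibleAt ι π ρ v` holds at every `v ∤ ℓ`, hence the
`𝓡`-free conjunct `∀ᶠ v, SatakeFrobCompatibleAt ι π ρ v` of `Corresponds 𝓡 ι π ρ` holds for every `𝓡`
(finitely many `v ∣ ℓ`, Mathlib `Ideal.finite_factors`); and the repaired `v ∣ ℓ` clause
`CrystallineCompatibleAt ι π ρ v hv` holds at EVERY `v ∣ ℓ`.  The arithmetic-Frobenius convention of clause (C)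
and the `φ^{f}`-convention of D2-cris are thereby checked against each other on genuine terms for every `k`.
[cite: BuzzardGeeLMS2014, Conj. 3.2.1 and Conj. 3.2.2] [cite: SerreAbelianLadic1968, Ch. I §1.2 (Example: the cyclotomic character)] -/
theorem exists_glOne_tate_pair (ι : PadicAlgCl ℓ ≃+* ℂ) (k : ℕ) :
    ∃ π : AutomorphicRepData (AutomorphyDatum.gl 1 K hcpt),
      π.W = Submodule.span ℂ
          {fun g : (AdelicGroupData.gl 1 K).Adelic => (detTwist 1 (HeckeCharacter.normCharacter K ^ k) g : ℂ)} ∧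
        π.W' = ⊥ ∧
        (∀ v : HeightOneSpectrum (𝓞 K), π.HasSatakeParamAt v {((v.residueCard : ℂ) ^ k)⁻¹}) ∧
        (∀ v : HeightOneSpectrum (𝓞 K), ((ℓ : ℕ) : 𝓞 K) ∉ v.asIdeal →
          SatakeFrobCompatibleAt ι π (FramedRep.twist (1 : FramedGaloisRep K (PadicAlgCl ℓ) 1) (tateChar K ℓ k)) v) ∧
        (∀ᶠ v : HeightOneSpectrum (𝓞 K) in cofinite,
          SatakeFrobCompatibleAt ι π (FramedRep.twist (1 : FramedGaloisRep K (PadicAlgCl ℓ) 1) (tateChar K ℓ k)) v) ∧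
        ∀ (v : HeightOneSpectrum (𝓞 K)) (hv : ((ℓ : ℕ) : 𝓞 K) ∈ v.asIdeal),
          CrystallineCompatibleAt ι π (FramedRep.twist (1 : FramedGaloisRep K (PadicAlgCl ℓ) 1) (tateChar K ℓ k))
            v hv := by
  obtain ⟨π, hW, hW'⟩ := exists_automorphicRepData_detTwist_glOne hcpt (HeckeCharacter.normCharacter K ^ k)
  have hev : ∀ᶠ v : HeightOneSpectrum (𝓞 K) in cofinite, ((ℓ : ℕ) : 𝓞 K) ∉ v.asIdeal := by
    have hℓ : (Ideal.span {((ℓ : ℕ) : 𝓞 K)} : Ideal (𝓞 K)) ≠ ⊥ := by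
      rw [Ne, Ideal.span_singleton_eq_bot, Nat.cast_eq_zero]
      exact (Fact.out : ℓ.Prime).ne_zero
    rw [Filter.eventually_cofinite]
    refine (Ideal.finite_factors hℓ).subset fun v hv => ?_
    simp only [Set.mem_setOf_eq, not_not] at hv ⊢
    exact (Ideal.dvd_span_singleton).mpr hv
  exact ⟨π, hW, hW', fun v => hasSatakeParamAt_normPow_glOne hcpt k hW hW' v,
    fun v hv => satakeFrobCompatibleAt_normPow_tateChar hcpt ι k hW hW' hv,
    hev.mono fun v hv => satakeFrobCompatibleAt_normPow_tateChar hcpt ι k hW hW' hv,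
    fun v hv => crystallineCompatibleAt_normPow_tateChar hcpt ι k hW hW' v hv⟩

end Tate

end D2Cris

end Summit.Langlands.Langlands.Theorems

end
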